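import Summits.QuantumFields.BalabanUV.T4Continuum.Support.NE7PairwiseCouplingDock

/-!
# NE7PairwiseScaleShift — row NE7 (node U5), route «PAIR-CAUCHY»: the NULL n-LAYER SCALE-SHIFT MODULUS (σ) consumed by
# `NE7PairwiseCouplingDock.couplingGap_tendsto_zero`, ordered BY NAME against the tree's currencies — (σ) follows from
# node U2's geometric `ScaleShiftRate` (telescoping over the `n` extra layers), and (σ) for the full β-functions follows
# from TAIL-CONVERGENCE of the one-loop coefficients plus (σ) for the remainder of the printed one-loop split

Cell `pub-balaban`, rung (B)+1 sub-cell t4, lineage `b2b-balaban-t4-ne7-p2` (CRUX PROVER NE7 #2 under the coordinator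
ruling «YM redirect», 2026-08-21; generation 49; route text `HOME/t4/b2b-balaban-t4-ne7-p2/g48/ROUTE2-NE7-P2.md` v1.3.1
§2 T.5♭).  HONEST FRAMING (page 1): FIXED FINITE T⁴, rung (B)+1 = existence AND uniqueness of the `ε = L^{−K} → 0` limit
of unit-scale averaged expectations, CONDITIONAL on BetaPertH and the nine spine estimates (0/9 proved); NOT infinite
volume, NOT a mass gap, NOT the Clay problem.  NE7 is NOT PRINTED in [Balaban1984PropagatorsI]–[Balaban1989LargeFieldII]
and NOT proved here.  Everything below is [folklore] real analysis over the tree's hypothesis SHAPES (`FlowStep`,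
`T4CouplingMatching.ScaleShiftRate`, `B12Beta.OneLoopSplit`); no definition, no cite tag, nothing printed asserted, no
`sorry`.

WHY.  The dock `NE7PairwiseCouplingDock.couplingGap_tendsto_zero` (p249585) consumes the marginal input of the route
«PAIR-CAUCHY» in the form
  (σ)  `∀ n k w ∈ box, |β (k+n) (prefixOf w (k+n)) − β k (prefixOf (fun i => w (i+n)) k)| ≤ σ k`, `σ → 0`:
the β-function produced at depth `k + n` and the one produced at depth `k`, evaluated on the same `k + 1` most recent
couplings, differ by a null modulus of the smaller depth, uniformly in the number `n` of extra ultraviolet layers and in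
their couplings.  This file places (σ) among the currencies the cell already has, BY NAME.  §1: node U2's CONSECUTIVE
GEOMETRIC rate `T4CouplingMatching.ScaleShiftRate c θ γ β` (`|β (k+1) w − β k (Fin.tail w)| ≤ cθ^k` — NE4, NOT PRINTED)
implies (σ) with `σ k = cθ^k∕(1−θ)` by telescoping over the `n` layers (`Fin.tail ∘ prefixOf = prefixOf ∘ shift`,
tree `T4CouplingMatching.tail_prefixOf`): the route's ask is WEAKER than node U2's, and `couplingGap_tendsto_zero`
therefore also holds under U2's own inputs (§3 `couplingGap_tendsto_zero_of_scaleShiftRate` — the consistency check that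
the null road consumes no more than the geometric road).  §2: for the PRINTED one-loop split `β_{k+1} = β⁰_{k+1} +
β¹_{k+1}(g_0,…,g_k)` ([Balaban1987RG1] (2.12)–(2.14) p. 268; tree `B12Beta.OneLoopSplit`, a structure over hypothesis
data), (σ) for the full `β` follows from a TAIL MODULUS of CONVERGENCE of the one-loop coefficients (`∀ j ≥ k,
|β⁰_j − β⁰_∞| ≤ c₀ k`, `c₀ → 0` — G-an2-4's (CONV-C) «as convergence, without rate», the qualitative reading recorded in
ROUTE2 §2 T.5♭) and (σ) for the remainder `β¹` with modulus `σ₁` (the wall (γ2)∕(γ3) in null currency): `σ = 2c₀ + σ₁`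
(`nullShift_of_split`, the null twin of `T4CouplingMatching.scaleShiftRate_of_split`).  Nothing here produces `c₀` or
`σ₁`; they are THE asks of the route in the marginal channel.

WHAT IS PROVED ([folklore]).
§1 `nullShift_sum_of_scaleShiftRate` (`≤ Σ_{i<n} cθ^{k+i}`), **`nullShift_of_scaleShiftRate`** (`≤ cθ^k∕(1−θ)`),
   `tendsto_geomShift` (`cθ^k∕(1−θ) → 0`).
§2 **`nullShift_of_split`** (`σ = 2c₀ + σ₁`), `tendsto_splitShift` (`2c₀ + σ₁ → 0`).
§3 **`couplingGap_tendsto_zero_of_scaleShiftRate`** — the dock's conclusion under node U2's `ScaleShiftRate` (+ the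
   dock's other binders): `∀ m, |1∕(g K (K−m))² − 1∕(g (K+n K) (K−m+n K))²| → 0`.

NOT DELIVERED: `c₀` (rows an1–an4 ∕ G-an2-4), `σ₁` (the remainder's two-depth modulus — cell wall (γ2)∕(γ3)), any fact
about [Balaban1987RG1]'s (1.22).  NOT NE7 (spine 0/9 unchanged), NOT summit progress.  HONEST DEPENDENCY: continuum YM on
T⁴ ⇐ BetaPertH ∧ nine spine estimates (0/9 proved); BetaPertH ⇐ (D1) ∧ (D4) ∧ CAP+tail; G-an2-4 gates asym, D1 and
NE2/3/4.
-/

noncomputable section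

open Finset Filter Topology
open scoped BigOperators

namespace Summit.QuantumFields.BalabanUV.T4Continuum.NE7PairwiseScaleShift

open Literature.MathematicalPhysics.QuantumFieldTheory.Balaban1983to89
open Literature.MathematicalPhysics.QuantumFieldTheory.Balaban1983to89.FlowStep
open Literature.MathematicalPhysics.QuantumFieldTheory.Balaban1983to89.T4CouplingMatching

/-! ## §1 (σ) from node U2's geometric `ScaleShiftRate`, by telescoping over the extra layers -/

/-- TELESCOPING OVER THE `n` EXTRA LAYERS: under `ScaleShiftRate c θ γ β`, for every coupling sequence `w` with
`w_i ∈ ]0, γ]` for `i ≤ k + n`,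
`|β (k+n) (w_0,…,w_{k+n}) − β k (w_n,…,w_{k+n})| ≤ Σ_{i<n} c·θ^{k+i}` — peel the ultraviolet-most layer `n` times
(`Fin.tail (prefixOf w (m+1)) = prefixOf (fun i => w (i+1)) m`, tree `tail_prefixOf`). [folklore] -/
theorem nullShift_sum_of_scaleShiftRate {β : HBeta} {c θ γ : ℝ} (hS : ScaleShiftRate c θ γ β) :
    ∀ n k (w : ℕ → ℝ), (∀ i, i ≤ k + n → 0 < w i ∧ w i ≤ γ) →
      |β (k + n) (prefixOf w (k + n)) - β k (prefixOf (fun i => w (i + n)) k)|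
        ≤ ∑ i ∈ range n, c * θ ^ (k + i) := by
  intro n
  induction n with
  | zero =>
    intro k w _
    have e : β (k + 0) (prefixOf w (k + 0)) = β k (prefixOf (fun i => w (i + 0)) k) := rfl
    rw [e, sub_self, abs_zero, sum_range_zero]
  | succ n ih =>
    intro k w hw
    -- peel the finest layer: `β (k+n+1) (w_{≤ k+n+1}) − β (k+n) (w_{1 ≤ · ≤ k+n+1})`
    have hbox : prefixOf w (k + n + 1) ∈ Box γ (k + n + 1) :=
      prefixOf_mem_box (N := k + n + 1) le_rfl fun i hi => hw i (by omega)
    have h1 := hS (k + n) (prefixOf w (k + n + 1)) hbox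
    rw [tail_prefixOf] at h1
    -- the remaining `n` layers, for the shifted sequence
    have h2 := ih k (fun j => w (j + 1)) fun i hi => hw (i + 1) (by omega)
    have e1 : prefixOf (fun i => (fun j => w (j + 1)) (i + n)) k = prefixOf (fun i => w (i + (n + 1))) k := rfl
    rw [e1] at h2
    have e2 : (k + (n + 1)) = k + n + 1 := rfl
    rw [e2, sum_range_succ]
    calc |β (k + n + 1) (prefixOf w (k + n + 1)) - β k (prefixOf (fun i => w (i + (n + 1))) k)|
        ≤ |β (k + n + 1) (prefixOf w (k + n + 1)) - β (k + n) (prefixOf (fun i => w (i + 1)) (k + n))|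
          + |β (k + n) (prefixOf (fun i => w (i + 1)) (k + n)) - β k (prefixOf (fun i => w (i + (n + 1))) k)| :=
          abs_sub_le _ _ _
      _ ≤ c * θ ^ (k + n) + ∑ i ∈ range n, c * θ ^ (k + i) := add_le_add h1 h2
      _ = ∑ i ∈ range n, c * θ ^ (k + i) + c * θ ^ (k + n) := add_comm _ _

/-- **(σ) FROM NODE U2's `ScaleShiftRate`.**  With `0 ≤ θ < 1` and `0 ≤ c`: for all `n, k` and all `w` in the box up
to `k + n`, `|β (k+n) (prefixOf w (k+n)) − β k (prefixOf (fun i => w (i+n)) k)| ≤ c·θ^k∕(1−θ)` — the route «PAIR-CAUCHY»'s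
marginal ask (σ), with `σ k = cθ^k∕(1−θ)`, is WEAKER than node U2's geometric rate. [folklore] -/
theorem nullShift_of_scaleShiftRate {β : HBeta} {c θ γ : ℝ} (hθ0 : 0 ≤ θ) (hθ1 : θ < 1) (hc : 0 ≤ c)
    (hS : ScaleShiftRate c θ γ β) :
    ∀ n k (w : ℕ → ℝ), (∀ i, i ≤ k + n → 0 < w i ∧ w i ≤ γ) →
      |β (k + n) (prefixOf w (k + n)) - β k (prefixOf (fun i => w (i + n)) k)| ≤ c * θ ^ k / (1 - θ) := by
  intro n k w hw
  refine (nullShift_sum_of_scaleShiftRate hS n k w hw).trans ?_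
  have hgeom : ∑ i ∈ range n, θ ^ i ≤ (1 - θ)⁻¹ := by
    rw [← tsum_geometric_of_lt_one hθ0 hθ1]
    exact (summable_geometric_of_lt_one hθ0 hθ1).sum_le_tsum _ fun i _ => pow_nonneg hθ0 i
  calc ∑ i ∈ range n, c * θ ^ (k + i) = c * θ ^ k * ∑ i ∈ range n, θ ^ i := by
        rw [mul_sum]; exact sum_congr rfl fun i _ => by rw [pow_add]; ring
    _ ≤ c * θ ^ k * (1 - θ)⁻¹ := mul_le_mul_of_nonneg_left hgeom (mul_nonneg hc (pow_nonneg hθ0 k))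
    _ = c * θ ^ k / (1 - θ) := by rw [div_eq_mul_inv]

/-- The geometric modulus is null: `cθ^k∕(1−θ) → 0` for `0 ≤ θ < 1`. [folklore] -/
theorem tendsto_geomShift {c θ : ℝ} (hθ0 : 0 ≤ θ) (hθ1 : θ < 1) :
    Tendsto (fun k => c * θ ^ k / (1 - θ)) atTop (𝓝 0) := by
  have h := (tendsto_pow_atTop_nhds_zero_of_lt_one hθ0 hθ1).const_mul c
  have h' := h.div_const (1 - θ)
  simpa using h'

/-! ## §2 (σ) for the full β from the printed one-loop split: tail-convergence of `β⁰` + (σ) for the remainder -/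

/-- **(σ) FOR THE FULL β-FUNCTIONS FROM THE ONE-LOOP SPLIT** (null twin of `T4CouplingMatching.scaleShiftRate_of_split`).
For the printed split `β = β⁰ + β¹` (`B12Beta.OneLoopSplit`, (2.12)–(2.14) p. 268): a TAIL MODULUS of convergence of the
one-loop coefficients, `∀ j ≥ k, |β⁰_j − β⁰_∞| ≤ c₀ k` (G-an2-4's (CONV-C) read as convergence without rate — NOT PRINTED,
a hypothesis), and (σ) for the remainder with modulus `σ₁` (the cell's wall (γ2)∕(γ3) in null currency — NOT PRINTED, a
hypothesis) give (σ) for `β` with `σ = 2c₀ + σ₁` (triangle inequality through `β⁰_∞`). [folklore] -/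
theorem nullShift_of_split {β : HBeta} (S : B12Beta.OneLoopSplit β) {γ binf : ℝ} {c₀ σ₁ : ℕ → ℝ}
    (hconv : ∀ k j, k ≤ j → |S.β0 j - binf| ≤ c₀ k)
    (hrem : ∀ n k (w : ℕ → ℝ), (∀ i, i ≤ k + n → 0 < w i ∧ w i ≤ γ) →
      |S.β1 (k + n) (prefixOf w (k + n)) - S.β1 k (prefixOf (fun i => w (i + n)) k)| ≤ σ₁ k) :
    ∀ n k (w : ℕ → ℝ), (∀ i, i ≤ k + n → 0 < w i ∧ w i ≤ γ) →
      |β (k + n) (prefixOf w (k + n)) - β k (prefixOf (fun i => w (i + n)) k)| ≤ 2 * c₀ k + σ₁ k := by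
  intro n k w hw
  have h1 := hconv k (k + n) (Nat.le_add_right k n)
  have h2 := hconv k k le_rfl
  have h3 := hrem n k w hw
  have e : β (k + n) (prefixOf w (k + n)) - β k (prefixOf (fun i => w (i + n)) k)
      = (S.β0 (k + n) - binf) - (S.β0 k - binf)
        + (S.β1 (k + n) (prefixOf w (k + n)) - S.β1 k (prefixOf (fun i => w (i + n)) k)) := by
    rw [S.split (k + n), S.split k]; ring
  rw [e]
  calc |(S.β0 (k + n) - binf) - (S.β0 k - binf)
          + (S.β1 (k + n) (prefixOf w (k + n)) - S.β1 k (prefixOf (fun i => w (i + n)) k))|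
      ≤ |S.β0 (k + n) - binf| + |S.β0 k - binf|
          + |S.β1 (k + n) (prefixOf w (k + n)) - S.β1 k (prefixOf (fun i => w (i + n)) k)| :=
        (abs_add_le _ _).trans (add_le_add (abs_sub _ _) le_rfl)
    _ ≤ c₀ k + c₀ k + σ₁ k := add_le_add (add_le_add h1 h2) h3
    _ = 2 * c₀ k + σ₁ k := by ring

/-- The split modulus is null when its pieces are: `c₀ → 0`, `σ₁ → 0` ⟹ `2c₀ + σ₁ → 0`. [folklore] -/
theorem tendsto_splitShift {c₀ σ₁ : ℕ → ℝ} (hc : Tendsto c₀ atTop (𝓝 0)) (hσ : Tendsto σ₁ atTop (𝓝 0)) :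
    Tendsto (fun k => 2 * c₀ k + σ₁ k) atTop (𝓝 0) := by
  simpa using (hc.const_mul 2).add hσ

/-! ## §3 Consistency: the dock's conclusion under node U2's own inputs -/

/-- **LEAF T.5♭ UNDER NODE U2's GEOMETRIC INPUTS** (the null road consumes no more than the geometric road).  The binders
of `NE7PairwiseCouplingDock.couplingGap_tendsto_zero` with the null modulus (σ) REPLACED by `ScaleShiftRate c θ′ γ β`
(`0 ≤ θ′ < 1`, `0 ≤ c` — NE4, NOT PRINTED) give the same conclusion: for every block scale `m`,
`|1∕(g K (K−m))² − 1∕(g (K+n K) (K−m+n K))²| → 0`.  (Under these inputs `T4CouplingMatching.injectedRate_of_runs_eventual`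
gives MORE — a geometric rate for consecutive runs; this corollary only records that the pairwise null statement is
implied.)  Bookkeeping over UNPRINTED inputs. [folklore] -/
theorem couplingGap_tendsto_zero_of_scaleShiftRate {β : HBeta} {γ b β' C θ θ' c q gIR : ℝ} {k₀ : ℕ}
    {Λ : ℕ → ℕ → ℝ} (g : ℕ → ℕ → ℝ) (n : ℕ → ℕ)
    (hγ : 0 < γ) (hb : 0 < b) (hθ0 : 0 ≤ θ) (hθ1 : θ < 1) (hC : 0 ≤ C) (hβ' : 0 ≤ β')
    (hθ'0 : 0 ≤ θ') (hθ'1 : θ' < 1) (hc : 0 ≤ c)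
    (hrun : ∀ N, RGEqH N β (g N)) (hbox : ∀ N i, i ≤ N → 0 < g N i ∧ g N i ≤ γ)
    (hpin : ∀ N, g N N = gIR)
    (hL : HistLipschitz Λ γ β) (hΛ : FadingMemory C θ Λ)
    (hlo : EventualLowerH b γ k₀ β) (hup : BetaUpperH β' γ β)
    (hS : ScaleShiftRate c θ' γ β)
    (hq : C * ((((k₀ : ℝ) + 1) * γ ^ 3 + 2 * γ / b) / (1 - θ)) ≤ q) (hq1 : q < 1) :
    ∀ m, Tendsto (fun K => |1 / (g K (K - m)) ^ 2 - 1 / (g (K + n K) (K - m + n K)) ^ 2|)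
      atTop (𝓝 0) :=
  NE7PairwiseCouplingDock.couplingGap_tendsto_zero g n hγ hb hθ0 hθ1 hC hβ' hrun hbox hpin hL hΛ hlo hup
    (nullShift_of_scaleShiftRate hθ'0 hθ'1 hc hS) (tendsto_geomShift hθ'0 hθ'1) hq hq1

end Summit.QuantumFields.BalabanUV.T4Continuum.NE7PairwiseScaleShift

end
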